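/-
Copyright: lit-balaban cell, Phase-2 proof seat p03.  Reproduction of published definitions and of an elementary published
claim; nothing is claimed beyond what the kernel checks below.
-/
import Mathlib
import Literature.MathematicalPhysics.QuantumFieldTheory.BalabanImbrieJaffe1984to88.BIJ85AxialGauge35

/-!
# `BalabanImbrieJaffe1984to88.BIJ85Eq311Proof` — T. Bałaban, J. Imbrie, A. Jaffe, *Renormalization of the Higgs model:
minimizers, propagators and the stability of mean field theory*, Commun. Math. Phys. **97** (1985) 299–329
[BalabanImbrieJaffe1985]: Sect. 3 p. 307, (3.9)–(3.12) — the unit-lattice field u′ with block averages equal to 1: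
(3.9)–(3.10), (3.12) typed on the concrete carrier, **(3.11) (Qu′)_{b′} = 1 PROVED**

statement-level skeleton of published theorems with citation tags; proofs where landed; nothing here is a claim about
the Yang–Mills mass gap

PDF held: `paper:balaban1985-cmp97-bij-higgs-minimizers` (journal page = PDF page + 298); p. 307 [PDF 9] read on the render
`HOME/lit-balaban-r15/pages/1985-cmp97-bij-higgs-minimizers-p009-x2.png`; pp. 303–304 [PDF 5–6] for (2.10), (2.15).
SKELETON row `C1.Eq3.9-3.12` (`HOME/lit-balaban-r15/ROWS-C1.md` r15-C1-31, status `absent`; owner r15, referee ref-5);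
Phase-2 seat p03 (finished its line C1.Eq3.4-3.6 — `BIJ85AxialGauge34`/`35` — and takes this dependant row under
G.5-34(d)), unit `lit-balaban-p03`, HOME `run/shared/lean/pub/lit-balaban/`.

THE PRINTED TEXT (p. 307 [PDF 9], verbatim).  *"We begin the study of (3.1) by rewriting the Wilson action contribution to
S(u, φ). First define a unit lattice field u′_b with block averages equal to 1. In this way we can write the resulting u′_b
in terms of a vector potential which fluctuates about zero. Let  (u′)_b = u_b, if b ∉ B^s(b′), u_bv_{b′}^{−1}, if
b ∈ B^s(b′) (3.9)  be given in terms of the averaging operator Q of (2.10), where  v_{b′} = (Qu)_{b′}. (3.10)  It then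
follows that  (Qu′)_{b′} = 1 (3.11)  for all L-lattice bonds b′. Now define A′_b by  (u′)_b = exp(ie(ε)A′_b). (3.12)"*
With it (2.15) p. 304 [PDF 6]: *"let B^s(b′) denote L^{d−1} bonds on the unit lattice which are parallel to b′ and which join
the block B(b′₋) to B(b′₊). We call these bonds surface bonds since they cross the surfaces of blocks, see Fig. 1."*

CARRIER: as in `BIJ85AxialGauge34`/`35` — the corner-anchored ℤ^d unit lattice of `…Balaban1983to89.B6BondElimination`
(sites `Fin d → ℤ`, unit bonds `(Fin d → ℤ) × Fin d` = ⟨z, z + e_μ⟩, blocks `block L y`, corners `corner L x`),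
U(1) = `Circle`, the L-lattice bonds b′ = ⟨y, y + Le_μ⟩ indexed by `(y, μ)`, y ∈ LZ^d, and Q = the concrete (2.10)
`BIJ85AxialGauge35.qU` (straight contours `run`, closed contour `loop210`, block transports `BIJ85AxialGauge34.hol`).  The
surface bonds B^s(b′) of (2.15) on this carrier: `IsSurfaceBondOf` (the printed description) ⇔ `(b₋)_μ ≡ L − 1 (mod L)`
with b′ = ⟨corner b₋, ·⟩ (`isSurfaceBondOf_iff`), which is the decidable test used in the body of (3.9).  (The cell's
abstract two-scale bond geometry `BIJ85Sect2SurfaceAverages.BlockBonds.Bs` types B^s(b′) as data; dictionary only.)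

WHAT IS TYPED (defs with bodies) / PROVED.
* **(2.15)** `IsSurfaceBondOf L c b` and its arithmetic form `isSurfaceBondOf_iff`; tree bonds are never surface bonds
  (`not_surface_of_mem_treeBonds`).
* **(3.9)** `uPrime L u v` with the two printed cases as theorems (`uPrime_of_surface`, `uPrime_of_not_surface`);
  **(3.10)** `v310 L u = qU L u`; **(3.12)** `aPrime eε u′ b = argB(u′_b)/e(ε)` with `exp_aPrime` (u′_b = exp(ie(ε)A′_b)).
* THE MECHANISM, PROVED: the block transports u(Γ_{yx}) do not see the surface bonds (`hol_uPrime`); each straight contour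
  Γ_{xx′}, x ∈ B(y), crosses B^s(⟨y, y′⟩) in exactly one bond, so u′(Γ_{xx′}) = u(Γ_{xx′})v_{b′}^{−1} (`run_uPrime`); the
  closed contour of (2.10) is unchanged (`loop210_uPrime`); hence (Qu′)_{b′} = v_{b′}^{−1}(Qu)_{b′} for ANY L-lattice field v
  (`qU_uPrime`) and **(3.11)** *"It then follows that (Qu′)_{b′} = 1 for all L-lattice bonds b′"* with v = Qu (`eq311`).
NOT DONE HERE.  (3.13)–(3.14) (the Wilson action rewritten in A′, with its O(e(ε)²) remainder) — row C1.Eq3.13-3.14.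
-/

open Finset

namespace Literature.MathematicalPhysics.QuantumFieldTheory.BalabanImbrieJaffe1984to88.BIJ85Eq311Proof

open Literature.MathematicalPhysics.QuantumFieldTheory.Balaban1983to89
open B6Elimination B6BondElimination BIJ85AxialGauge34 BIJ85AxialGauge35

noncomputable section

variable {d : ℕ} {L : ℕ}

/-! ## §1 Surface bonds (2.15) on the concrete carrier -/

/-- **(2.15)** *"B^s(b′) denote[s] L^{d−1} bonds on the unit lattice which are parallel to b′ and which join the block
B(b′₋) to B(b′₊)"*: for b′ = ⟨y, y + Le_μ⟩ (`c = (y, μ)`) the unit bonds b = ⟨z, z + e_μ⟩ with z ∈ B(y) on the face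
z_μ = y_μ + L − 1 (so that z + e_μ ∈ B(y + Le_μ)). [cite: BalabanImbrieJaffe1985, (2.15) p.304] -/
def IsSurfaceBondOf (L : ℕ) (c b : (Fin d → ℤ) × Fin d) : Prop :=
  b.2 = c.2 ∧ b.1 ∈ block L c.1 ∧ b.1 b.2 = c.1 c.2 + L - 1

/-- Block arithmetic: for z ∈ B(y), y ∈ LZ^d, z_i mod L = z_i − y_i. [cite: BalabanImbrieJaffe1985, (2.4) p.302] -/
theorem emod_eq_sub_of_mem_block {y z : Fin d → ℤ} (hy : ∀ i, (L : ℤ) ∣ y i) (hz : z ∈ block L y) (i : Fin d) :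
    z i % (L : ℤ) = z i - y i := by
  obtain ⟨k, hk⟩ := hy i
  obtain ⟨h1, h2⟩ := mem_block.1 hz i
  have e : z i = (z i - y i) + (L : ℤ) * k := by rw [← hk]; ring
  rw [e, Int.add_mul_emod_self_left, Int.emod_eq_of_lt (by omega) (by omega)]
  omega

/-- The printed description (2.15) ⇔ the arithmetic test used in (3.9): b ∈ B^s(b′) for the L-lattice bond b′ (corner in
LZ^d) iff (b₋)_μ ≡ L − 1 (mod L) and b′ = ⟨corner(b₋), corner(b₋) + Le_μ⟩, μ the direction of b.
[cite: BalabanImbrieJaffe1985, (2.15) p.304] -/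
theorem isSurfaceBondOf_iff (hL : 0 < L) {c : (Fin d → ℤ) × Fin d} (hc : ∀ i, (L : ℤ) ∣ c.1 i)
    (b : (Fin d → ℤ) × Fin d) :
    IsSurfaceBondOf L c b ↔ b.1 b.2 % (L : ℤ) = L - 1 ∧ c = (corner L b.1, b.2) := by
  constructor
  · rintro ⟨h2, hz, h3⟩
    have hcor : corner L b.1 = c.1 := by
      rw [← corner_eq_self_of_dvd c.1 hc] at hz
      rw [corner_eq_of_mem_block hL hz, corner_eq_self_of_dvd c.1 hc]
    refine ⟨?_, ?_⟩
    · rw [emod_eq_sub_of_mem_block hc hz, h3, h2]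
      ring
    · rw [hcor, h2]
  · rintro ⟨hm, rfl⟩
    refine ⟨rfl, mem_block_corner hL b.1, ?_⟩
    have e := Int.mul_ediv_add_emod (b.1 b.2) (L : ℤ)
    rw [hm] at e
    show b.1 b.2 = corner L b.1 b.2 + L - 1
    rw [corner_apply]
    omega

/-- A tree bond of a block is not a surface bond (its two end-points lie in the same block): T(y) ∩ B^s(b′) = ∅.
[cite: BalabanImbrieJaffe1985, (2.15) p.304] -/
theorem not_surface_of_mem_treeBonds {y : Fin d → ℤ} (hy : ∀ i, (L : ℤ) ∣ y i) {b : (Fin d → ℤ) × Fin d}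
    (hb : b ∈ treeBonds L y) : b.1 b.2 % (L : ℤ) ≠ L - 1 := by
  obtain ⟨hz, -, h2⟩ := mem_treeBonds.1 hb
  rw [emod_eq_sub_of_mem_block hy hz]
  omega

/-! ## §2 (3.9), (3.10), (3.12) -/

/-- **(3.9)** *"(u′)_b = u_b, if b ∉ B^s(b′), u_bv_{b′}^{−1}, if b ∈ B^s(b′)"* — typed with the arithmetic surface test of
`isSurfaceBondOf_iff` (b′ = the L-lattice bond ⟨corner(b₋), ·⟩ parallel to b), for any L-lattice field v.
[cite: BalabanImbrieJaffe1985, (3.9) p.307] -/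
def uPrime (L : ℕ) (u : U1Cfg d) (v : (Fin d → ℤ) × Fin d → Circle) : U1Cfg d :=
  fun b => if b.1 b.2 % (L : ℤ) = L - 1 then u b * (v (corner L b.1, b.2))⁻¹ else u b

/-- (3.9), second case as printed: b ∈ B^s(b′) ⇒ u′_b = u_b v_{b′}^{−1}. [cite: BalabanImbrieJaffe1985, (3.9) p.307] -/
theorem uPrime_of_surface (hL : 0 < L) (u : U1Cfg d) (v : (Fin d → ℤ) × Fin d → Circle) {c b : (Fin d → ℤ) × Fin d}
    (hc : ∀ i, (L : ℤ) ∣ c.1 i) (hb : IsSurfaceBondOf L c b) : uPrime L u v b = u b * (v c)⁻¹ := by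
  obtain ⟨hm, hcb⟩ := (isSurfaceBondOf_iff hL hc b).1 hb
  simp only [uPrime, if_pos hm, hcb]

/-- (3.9), first case as printed: b in no B^s(b′) ⇒ u′_b = u_b. [cite: BalabanImbrieJaffe1985, (3.9) p.307] -/
theorem uPrime_of_not_surface (hL : 0 < L) (u : U1Cfg d) (v : (Fin d → ℤ) × Fin d → Circle) {b : (Fin d → ℤ) × Fin d}
    (hb : ∀ c : (Fin d → ℤ) × Fin d, (∀ i, (L : ℤ) ∣ c.1 i) → ¬ IsSurfaceBondOf L c b) : uPrime L u v b = u b := by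
  have hm : ¬ b.1 b.2 % (L : ℤ) = L - 1 := fun hm =>
    hb (corner L b.1, b.2) (dvd_corner b.1) ((isSurfaceBondOf_iff hL (dvd_corner b.1) b).2 ⟨hm, rfl⟩)
  simp only [uPrime, if_neg hm]

/-- **(3.10)** *"v_{b′} = (Qu)_{b′}"* — the block averages (2.10) of u. [cite: BalabanImbrieJaffe1985, (3.10) p.307] -/
def v310 (L : ℕ) (u : U1Cfg d) : (Fin d → ℤ) × Fin d → Circle := qU L u

/-- **(3.12)** *"Now define A′_b by (u′)_b = exp(ie(ε)A′_b)"* — with the branch (2.11): A′_b = argB(u′_b)/e(ε).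
[cite: BalabanImbrieJaffe1985, (3.12) p.307] -/
def aPrime (eε : ℝ) (u' : U1Cfg d) (b : (Fin d → ℤ) × Fin d) : ℝ := BIJ85Sect1Model.argB (u' b : ℂ) / eε

/-- (3.12) holds for `aPrime`: u′_b = exp(ie(ε)A′_b) (e(ε) ≠ 0). [cite: BalabanImbrieJaffe1985, (3.12) p.307] -/
theorem exp_aPrime (eε : ℝ) (heε : eε ≠ 0) (u' : U1Cfg d) (b : (Fin d → ℤ) × Fin d) :
    Complex.exp ((eε * aPrime eε u' b : ℝ) * Complex.I) = (u' b : ℂ) := by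
  have : eε * aPrime eε u' b = BIJ85Sect1Model.argB (u' b : ℂ) := by
    unfold aPrime
    field_simp
  rw [this, BIJ85Sect1Model.exp_argB]

/-! ## §3 (3.11): the block averages of u′ -/

/-- The block transports do not see the surface shift: u′(Γ_{yx}) = u(Γ_{yx}) for x ∈ B(y), y ∈ LZ^d (Γ_{yx} ⊂ T(y) has no
surface bond). [cite: BalabanImbrieJaffe1985, (3.11) p.307] -/
theorem hol_uPrime (u : U1Cfg d) (v : (Fin d → ℤ) × Fin d → Circle) {y : Fin d → ℤ} (hy : ∀ i, (L : ℤ) ∣ y i)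
    {x : Fin d → ℤ} (hx : x ∈ block L y) : hol L (uPrime L u v) y x = hol L u y x := by
  unfold hol
  refine Finset.prod_congr rfl fun b hb => ?_
  simp only [uPrime, if_neg (not_surface_of_mem_treeBonds hy (contour_subset_treeBonds hx hb))]

/-- Each straight contour Γ_{xx′} = [x, x + Le_μ], x ∈ B(y), crosses B^s(⟨y, y + Le_μ⟩) in exactly one bond (the one
leaving the face z_μ = y_μ + L − 1), so u′(Γ_{xx′}) = u(Γ_{xx′})v_{b′}^{−1}. [cite: BalabanImbrieJaffe1985, (3.11) p.307] -/
theorem run_uPrime (hL : 0 < L) (u : U1Cfg d) (v : (Fin d → ℤ) × Fin d → Circle) {y : Fin d → ℤ}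
    (hy : ∀ i, (L : ℤ) ∣ y i) (μ : Fin d) {x : Fin d → ℤ} (hx : x ∈ block L y) :
    run (uPrime L u v) x μ L = run u x μ L * (v (y, μ))⁻¹ := by
  obtain ⟨hx1, hx2⟩ := mem_block.1 hx μ
  -- the crossing parameter t⋆ = y_μ + L − 1 − x_μ ∈ [0, L)
  set ts : ℕ := (y μ + L - 1 - x μ).toNat with hts
  have hts' : (ts : ℤ) = y μ + L - 1 - x μ := by rw [hts]; exact Int.toNat_of_nonneg (by omega)
  have hts_mem : ts ∈ Finset.range L := by
    rw [Finset.mem_range]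
    have : (ts : ℤ) < L := by omega
    exact_mod_cast this
  -- the value of u′ on the t-th bond of the straight contour
  have key : ∀ t ∈ Finset.range L, uPrime L u v (x + (t : ℤ) • unitVec μ, μ) =
      u (x + (t : ℤ) • unitVec μ, μ) * (if t = ts then (v (y, μ))⁻¹ else 1) := by
    intro t ht
    rw [Finset.mem_range] at ht
    have htL : (t : ℤ) < L := by exact_mod_cast ht
    have hcoord : (x + (t : ℤ) • unitVec μ) μ = x μ + t := by rw [add_smul_unitVec_apply, if_pos rfl]
    by_cases hlow : x μ + t < y μ + L
    · -- the bond starts in B(y)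
      have hzb : x + (t : ℤ) • unitVec μ ∈ block L y := by
        rw [mem_block]
        intro i
        rw [add_smul_unitVec_apply]
        obtain ⟨h1, h2⟩ := mem_block.1 hx i
        split_ifs with hi
        · subst hi; omega
        · omega
      have hm : (x + (t : ℤ) • unitVec μ) μ % (L : ℤ) = x μ + t - y μ := by
        rw [emod_eq_sub_of_mem_block hy hzb μ, hcoord]
      by_cases ht' : t = ts
      · subst ht'
        have hcond : (x + (ts : ℤ) • unitVec μ) μ % (L : ℤ) = L - 1 := by rw [hm]; omega
        have hcor : corner L (x + (ts : ℤ) • unitVec μ) = y := by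
          rw [← corner_eq_self_of_dvd y hy] at hzb
          rw [corner_eq_of_mem_block hL hzb, corner_eq_self_of_dvd y hy]
        simp only [uPrime, if_pos hcond, hcor, if_true]
      · have hcond : ¬ (x + (t : ℤ) • unitVec μ) μ % (L : ℤ) = L - 1 := by rw [hm]; omega
        simp only [uPrime, if_neg hcond, if_neg ht', mul_one]
    · -- the bond starts in the next block B(y + Le_μ): not a surface bond, and t ≠ t⋆
      have hy' : ∀ i, (L : ℤ) ∣ (y + (L : ℤ) • unitVec μ) i := fun i => by
        rw [add_smul_unitVec_apply]
        split_ifs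
        · exact dvd_add (hy i) (dvd_refl _)
        · simpa using hy i
      have hzb : x + (t : ℤ) • unitVec μ ∈ block L (y + (L : ℤ) • unitVec μ) := by
        rw [mem_block]
        intro i
        rw [add_smul_unitVec_apply, add_smul_unitVec_apply]
        obtain ⟨h1, h2⟩ := mem_block.1 hx i
        split_ifs with hi
        · subst hi; omega
        · omega
      have hm : (x + (t : ℤ) • unitVec μ) μ % (L : ℤ) = x μ + t - (y μ + L) := by
        rw [emod_eq_sub_of_mem_block hy' hzb μ, hcoord, add_smul_unitVec_apply, if_pos rfl]
      have hcond : ¬ (x + (t : ℤ) • unitVec μ) μ % (L : ℤ) = L - 1 := by rw [hm]; omega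
      have ht' : t ≠ ts := by intro e; rw [e] at hlow; omega
      simp only [uPrime, if_neg hcond, if_neg ht', mul_one]
  unfold run
  rw [Finset.prod_congr rfl key, Finset.prod_mul_distrib, Finset.prod_ite_eq' (Finset.range L) ts, if_pos hts_mem]

/-- The closed contour of (2.10) does not see the surface shift (the two straight legs pick up the same factor v_{b′}^{−1},
one of them inverted). [cite: BalabanImbrieJaffe1985, (3.11) p.307] -/
theorem loop210_uPrime (hL : 0 < L) (u : U1Cfg d) (v : (Fin d → ℤ) × Fin d → Circle) {y : Fin d → ℤ}
    (hy : ∀ i, (L : ℤ) ∣ y i) (μ : Fin d) {x : Fin d → ℤ} (hx : x ∈ block L y) :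
    loop210 L (uPrime L u v) y μ x = loop210 L u y μ x := by
  have hy' : ∀ i, (L : ℤ) ∣ (y + (L : ℤ) • unitVec μ) i := fun i => by
    rw [add_smul_unitVec_apply]
    split_ifs
    · exact dvd_add (hy i) (dvd_refl _)
    · simpa using hy i
  have hyy : y ∈ block L y := mem_block.2 fun i => ⟨le_rfl, by omega⟩
  unfold loop210
  rw [hol_uPrime u v hy hx, hol_uPrime u v hy' (B6Lemma24PrintedShape.add_smul_mem_block hx μ), run_uPrime hL u v hy μ hx,
    run_uPrime hL u v hy μ hyy]
  apply Circle.ext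
  push_cast
  field_simp

/-- The block averages of the shifted field: (Qu′)_{b′} = v_{b′}^{−1}(Qu)_{b′} for every L-lattice bond b′ and every
L-lattice field v. [cite: BalabanImbrieJaffe1985, (3.11) p.307] -/
theorem qU_uPrime (hL : 0 < L) (u : U1Cfg d) (v : (Fin d → ℤ) × Fin d → Circle) {c : (Fin d → ℤ) × Fin d}
    (hc : ∀ i, (L : ℤ) ∣ c.1 i) : qU L (uPrime L u v) c = (v c)⁻¹ * qU L u c := by
  have hyy : c.1 ∈ block L c.1 := mem_block.2 fun i => ⟨le_rfl, by omega⟩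
  unfold qU
  rw [run_uPrime hL u v hc c.2 hyy]
  have e : ∑ x ∈ block L c.1, BIJ85Sect1Model.argB (loop210 L (uPrime L u v) c.1 c.2 x : ℂ) =
      ∑ x ∈ block L c.1, BIJ85Sect1Model.argB (loop210 L u c.1 c.2 x : ℂ) :=
    Finset.sum_congr rfl fun x hx => by rw [loop210_uPrime hL u v hc c.2 hx]
  rw [e]
  apply Circle.ext
  push_cast
  ring

/-- **(3.11)** *"It then follows that (Qu′)_{b′} = 1 for all L-lattice bonds b′"* (u′ of (3.9) with v = Qu of (3.10)).
PROVED. [cite: BalabanImbrieJaffe1985, (3.11) p.307] -/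
theorem eq311 (hL : 0 < L) (u : U1Cfg d) {c : (Fin d → ℤ) × Fin d} (hc : ∀ i, (L : ℤ) ∣ c.1 i) :
    qU L (uPrime L u (v310 L u)) c = 1 := by
  rw [qU_uPrime hL u _ hc, v310, inv_mul_cancel]

end

end Literature.MathematicalPhysics.QuantumFieldTheory.BalabanImbrieJaffe1984to88.BIJ85Eq311Proof
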